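import Literature.Analysis.FluidPDE.PineauVicolEnstrophy
import Literature.Analysis.FluidPDE.PineauVicolEnstrophyTime
import Literature.Analysis.FluidPDE.AncientSimilarityVorticity
import Literature.Analysis.FluidPDE.KNSSThm52Integrand
import Summits.NavierStokesRegularity.NavierStokesRegularity.Theorems.HubbleDynamoDilutionBudget
import HarnessLib

/-!
# Enstrophy balance of an eternal backward-Leray flow in the uniform profile class
# (route `HubbleDynamo`, crux `NoSelfExcitedDynamo`, line `registered`, stub `stub_enstrophyBalance`)

Helper file (all results proved) for the crux item stmt-NavierStokesRegularity-1934. For an eternal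
classical solution `(U, P)` of Leray's backward system `∂ₛU + ½U + ½(y·∇)U + (U·∇)U + ∇P = ΔU`,
`div U = 0` on `ℝ × ℝ³` (`IsBackwardLeraySolutionOn univ 1 U P`) in the uniform profile class
`(1+|y|)^{k+1}‖DᵏU(s)‖ ≤ K_k` with `|U| ≤ C₀`, the enstrophy `E(s) = ∫|curl U(s)|²` is finite, bounded
in `s`, and `E(s₁) − E(s₀) ≤ −½(1 − C₀²)∫_{s₀}^{s₁} E` for `s₀ ≤ s₁` (`stub_enstrophyBalance`).

Proof. One constant `K` controls `(1+|y|)|U|`, `(1+|y|)²‖DU‖`, `(1+|y|)³‖DΩ‖`, `(1+|y|)⁴|ΔΩ|`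
(`Ω = curl U`; `enstrophy_decay`), whence every density below is `O((1+|y|)⁻⁴)`
(`enstrophy_pointwise`, `enstrophy_slice_integrable`). (1) The slice identity
`∫⟪∂ₛΩ,Ω⟫ + ¼E + ∫|DΩ|²_F = ∫⟪Ω,(DU)Ω⟫` (`PineauVicol2026.enstrophy_slice`) and the stretching bound
`∫⟪Ω,(DU)Ω⟫ ≤ ∫‖DΩ‖² + (C₀²/4)E ≤ ∫|DΩ|²_F + (C₀²/4)E` (`enstrophy_stretch_le`: `div(⟪U,Ω⟫Ω) =
⟪Ω,(DU)Ω⟫ + ⟪U,(DΩ)Ω⟫` as `div Ω = 0`, `∫ div = 0` by `PineauVicol2026.integral_divergence_eq_zero_of_integrable_div`,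
Young pointwise) give `∫⟪∂ₛΩ,Ω⟫ ≤ −¼(1 − C₀²)E` on every slice (`enstrophy_slice_le`). (2) Fubini and
the fundamental theorem of calculus in `s` (pattern of
`PineauVicol2026.intervalIntegral_integral_inner_timeDeriv_vorticity_eq_zero`):
`∫_{s₀}^{s₁}∫⟪∂ₛΩ,Ω⟫ = ½(E(s₁) − E(s₀))`, with the `s`-uniform dominator `|⟪∂ₛΩ,Ω⟫| ≤ A(1+|y|)⁻⁴`
read off the vorticity equation `IsBackwardLeraySolutionOn.vorticity_eq`.
References: Pineau–Vicol 2026, (3.3)–(3.4), (7.12), §7.5; Leray 1934, §20; Backus 1958.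
-/

noncomputable section

-- tree namespace `Summit.<S>.<S>.Theorems…` (summit = sub-problem), as in every Theorems file
set_option linter.dupNamespace false

open Set MeasureTheory Filter Topology InnerProductSpace Function
open scoped RealInnerProductSpace Laplacian ContDiff

namespace Summit.NavierStokesRegularity.NavierStokesRegularity.Theorems.NoSelfExcitedDynamo.Registered

open Literature.Analysis.FluidPDE

/-! ### The profile class: one constant for `U`, `DU`, `DΩ`, `ΔΩ` -/

/-- From the uniform profile bounds `(1+|y|)^{k+1}‖DᵏU‖ ≤ K_k` (`k ≤ 3`): one constant `K ≥ 0`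
with `(1+|y|)|U| ≤ K`, `(1+|y|)²‖DU‖ ≤ K`, `(1+|y|)³‖D curl U‖ ≤ K`, `(1+|y|)⁴|Δ curl U| ≤ K`,
uniformly in `s` (`‖D curl U‖ ≤ κ‖D²U‖`, `|Δ curl U| ≤ 3‖D² curl U‖ ≤ 3κ‖D³U‖`, `κ = ‖curlCLM‖`). -/
theorem enstrophy_decay {U : ℝ → EuclideanSpace ℝ (Fin 3) → EuclideanSpace ℝ (Fin 3)}
    (hU : ∀ s, ContDiff ℝ 3 (U s))
    (hdec : ∀ k : ℕ, ∃ K : ℝ, ∀ s y, (1 + ‖y‖) ^ (k + 1) * ‖iteratedFDeriv ℝ k (U s) y‖ ≤ K) :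
    ∃ K : ℝ, 0 ≤ K ∧ ∀ s y, (1 + ‖y‖) * ‖U s y‖ ≤ K ∧ (1 + ‖y‖) ^ 2 * ‖fderiv ℝ (U s) y‖ ≤ K ∧
      (1 + ‖y‖) ^ 3 * ‖fderiv ℝ (curl (U s)) y‖ ≤ K ∧ (1 + ‖y‖) ^ 4 * ‖(Δ (curl (U s))) y‖ ≤ K := by
  obtain ⟨K₀, hK₀⟩ := hdec 0
  obtain ⟨K₁, hK₁⟩ := hdec 1
  obtain ⟨K₂, hK₂⟩ := hdec 2
  obtain ⟨K₃, hK₃⟩ := hdec 3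
  set κ : ℝ := ‖curlCLM‖ with hκ
  have hκ0 : 0 ≤ κ := by rw [hκ]; exact norm_nonneg curlCLM
  have n : 0 ≤ |K₀| ∧ 0 ≤ |K₁| ∧ 0 ≤ κ * |K₂| ∧ 0 ≤ 3 * κ * |K₃| := ⟨by positivity, by positivity, by positivity, by positivity⟩
  refine ⟨|K₀| + |K₁| + κ * |K₂| + 3 * κ * |K₃|, by positivity, fun s y => ⟨?_, ?_, ?_, ?_⟩⟩
  · have e : (1 + ‖y‖) * ‖U s y‖ ≤ K₀ := by simpa using hK₀ s y
    linarith [le_abs_self K₀, n.2.1, n.2.2.1, n.2.2.2]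
  · have e : (1 + ‖y‖) ^ 2 * ‖fderiv ℝ (U s) y‖ ≤ K₁ := by simpa using hK₁ s y
    linarith [le_abs_self K₁, n.1, n.2.2.1, n.2.2.2]
  · have h2 : ContDiff ℝ 2 (U s) := (hU s).of_le (by norm_cast)
    calc (1 + ‖y‖) ^ 3 * ‖fderiv ℝ (curl (U s)) y‖ ≤ (1 + ‖y‖) ^ 3 * (κ * ‖iteratedFDeriv ℝ 2 (U s) y‖) := by
          gcongr; exact norm_fderiv_curl_le h2 y
      _ = κ * ((1 + ‖y‖) ^ (2 + 1) * ‖iteratedFDeriv ℝ 2 (U s) y‖) := by ring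
      _ ≤ κ * |K₂| := mul_le_mul_of_nonneg_left ((hK₂ s y).trans (le_abs_self _)) hκ0
      _ ≤ _ := by linarith [n.1, n.2.1, n.2.2.2]
  · calc (1 + ‖y‖) ^ 4 * ‖(Δ (curl (U s))) y‖ ≤ (1 + ‖y‖) ^ 4 * (3 * (κ * ‖iteratedFDeriv ℝ 3 (U s) y‖)) := by
          gcongr
          exact (norm_laplacian_le_three_mul _ y).trans (mul_le_mul_of_nonneg_left
            (norm_iteratedFDeriv_curl_le (n := 2) (by exact_mod_cast hU s) y) (by norm_num))
      _ = 3 * κ * ((1 + ‖y‖) ^ (3 + 1) * ‖iteratedFDeriv ℝ 3 (U s) y‖) := by ring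
      _ ≤ 3 * κ * |K₃| := mul_le_mul_of_nonneg_left ((hK₃ s y).trans (le_abs_self _)) (by positivity)
      _ ≤ _ := by linarith [n.1, n.2.1, n.2.2.1]

/-! ### Pointwise bounds and integrability on one slice -/

/-- **Pointwise bounds in the profile class** for a field `V` with `(1+|y|)|V| ≤ K`,
`(1+|y|)²‖DV‖ ≤ K`, `(1+|y|)³‖DΩ‖ ≤ K`, `(1+|y|)⁴|ΔΩ| ≤ K` (`Ω = curl V`, `κ = ‖curlCLM‖`):
`(1+|y|)²|Ω| ≤ κK`, and the density of the time term of the enstrophy identity obeys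
`(1+|y|)⁴ ‖(DV)Ω + ΔΩ − Ω − ½(y·∇)Ω − (V·∇)Ω‖ |Ω| ≤ A`, `A = (K·κK + K + κK + K/2 + K·K)·κK`. -/
theorem enstrophy_pointwise {V : EuclideanSpace ℝ (Fin 3) → EuclideanSpace ℝ (Fin 3)} {K : ℝ} (hK0 : 0 ≤ K)
    (hK : ∀ y, (1 + ‖y‖) * ‖V y‖ ≤ K ∧ (1 + ‖y‖) ^ 2 * ‖fderiv ℝ V y‖ ≤ K ∧
      (1 + ‖y‖) ^ 3 * ‖fderiv ℝ (curl V) y‖ ≤ K ∧ (1 + ‖y‖) ^ 4 * ‖(Δ (curl V)) y‖ ≤ K)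
    (y : EuclideanSpace ℝ (Fin 3)) :
    (1 + ‖y‖) ^ 2 * ‖curl V y‖ ≤ ‖curlCLM‖ * K ∧
    (1 + ‖y‖) ^ 4 * (‖fderiv ℝ V y (curl V y) + (Δ (curl V)) y - curl V y
        - (1 / 2 : ℝ) • fderiv ℝ (curl V) y y - fderiv ℝ (curl V) y (V y)‖ * ‖curl V y‖) ≤
      (K * (‖curlCLM‖ * K) + K + ‖curlCLM‖ * K + K / 2 + K * K) * (‖curlCLM‖ * K) := by
  set κ : ℝ := ‖curlCLM‖ with hκ
  have hκ0 : 0 ≤ κ := by rw [hκ]; exact norm_nonneg curlCLM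
  have hr1 : (1 : ℝ) ≤ 1 + ‖y‖ := by linarith [norm_nonneg y]
  have hrm : ∀ m n : ℕ, m ≤ n → ∀ x : ℝ, 0 ≤ x → (1 + ‖y‖) ^ m * x ≤ (1 + ‖y‖) ^ n * x :=
    fun m n hmn x hx => mul_le_mul_of_nonneg_right (pow_le_pow_right₀ hr1 hmn) hx
  obtain ⟨hV, hDV, hDΩ, hΔ⟩ := hK y
  have hVK : ‖V y‖ ≤ K := (le_mul_of_one_le_left (norm_nonneg _) hr1).trans hV
  -- `(1+|y|)²|Ω| ≤ κK`
  have hΩ : (1 + ‖y‖) ^ 2 * ‖curl V y‖ ≤ κ * K := by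
    calc (1 + ‖y‖) ^ 2 * ‖curl V y‖ ≤ (1 + ‖y‖) ^ 2 * (κ * ‖fderiv ℝ V y‖) :=
          mul_le_mul_of_nonneg_left (norm_curl_le V y) (by positivity)
      _ = κ * ((1 + ‖y‖) ^ 2 * ‖fderiv ℝ V y‖) := by ring
      _ ≤ κ * K := mul_le_mul_of_nonneg_left hDV hκ0
  refine ⟨hΩ, ?_⟩
  -- the five terms of `∂ₛΩ`, each with `(1+|y|)² ‖·‖` bounded
  have t1 : (1 + ‖y‖) ^ 2 * ‖fderiv ℝ V y (curl V y)‖ ≤ K * (κ * K) := by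
    calc (1 + ‖y‖) ^ 2 * ‖fderiv ℝ V y (curl V y)‖ ≤ (1 + ‖y‖) ^ 2 * ‖fderiv ℝ V y‖ * ‖curl V y‖ := by
          rw [mul_assoc]; exact mul_le_mul_of_nonneg_left ((fderiv ℝ V y).le_opNorm _) (by positivity)
      _ ≤ K * ((1 + ‖y‖) ^ 2 * ‖curl V y‖) :=
          mul_le_mul hDV (le_mul_of_one_le_left (norm_nonneg _) (one_le_pow₀ hr1)) (norm_nonneg _) hK0
      _ ≤ K * (κ * K) := mul_le_mul_of_nonneg_left hΩ hK0
  have t2 : (1 + ‖y‖) ^ 2 * ‖(Δ (curl V)) y‖ ≤ K := (hrm 2 4 (by norm_num) _ (norm_nonneg _)).trans hΔ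
  have t4 : (1 + ‖y‖) ^ 2 * ‖(1 / 2 : ℝ) • fderiv ℝ (curl V) y y‖ ≤ K / 2 := by
    rw [norm_smul, Real.norm_of_nonneg (by norm_num : (0 : ℝ) ≤ 1 / 2)]
    have h1 : ‖fderiv ℝ (curl V) y y‖ ≤ ‖fderiv ℝ (curl V) y‖ * (1 + ‖y‖) := ((fderiv ℝ (curl V) y).le_opNorm y).trans
      (mul_le_mul_of_nonneg_left (by linarith [norm_nonneg y]) (norm_nonneg _))
    calc (1 + ‖y‖) ^ 2 * (1 / 2 * ‖fderiv ℝ (curl V) y y‖)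
        ≤ (1 + ‖y‖) ^ 2 * (1 / 2 * (‖fderiv ℝ (curl V) y‖ * (1 + ‖y‖))) := by gcongr
      _ = 1 / 2 * ((1 + ‖y‖) ^ 3 * ‖fderiv ℝ (curl V) y‖) := by ring
      _ ≤ K / 2 := by linarith [hDΩ]
  have t5 : (1 + ‖y‖) ^ 2 * ‖fderiv ℝ (curl V) y (V y)‖ ≤ K * K := by
    calc (1 + ‖y‖) ^ 2 * ‖fderiv ℝ (curl V) y (V y)‖ ≤ (1 + ‖y‖) ^ 2 * ‖fderiv ℝ (curl V) y‖ * ‖V y‖ := by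
          rw [mul_assoc]; exact mul_le_mul_of_nonneg_left ((fderiv ℝ (curl V) y).le_opNorm _) (by positivity)
      _ ≤ (1 + ‖y‖) ^ 3 * ‖fderiv ℝ (curl V) y‖ * K :=
          mul_le_mul (hrm 2 3 (by norm_num) _ (norm_nonneg _)) hVK (norm_nonneg _) (by positivity)
      _ ≤ K * K := mul_le_mul_of_nonneg_right hDΩ hK0
  have e5 : ∀ a b c d e : EuclideanSpace ℝ (Fin 3), ‖a + b - c - d - e‖ ≤ ‖a‖ + ‖b‖ + ‖c‖ + ‖d‖ + ‖e‖ :=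
    fun a b c d e => by
      linarith [norm_sub_le (a + b - c - d) e, norm_sub_le (a + b - c) d, norm_sub_le (a + b) c, norm_add_le a b]
  have hT : (1 + ‖y‖) ^ 2 * ‖fderiv ℝ V y (curl V y) + (Δ (curl V)) y - curl V y
      - (1 / 2 : ℝ) • fderiv ℝ (curl V) y y - fderiv ℝ (curl V) y (V y)‖ ≤ K * (κ * K) + K + κ * K + K / 2 + K * K := by
    have h := mul_le_mul_of_nonneg_left (e5 (fderiv ℝ V y (curl V y)) ((Δ (curl V)) y) (curl V y)
      ((1 / 2 : ℝ) • fderiv ℝ (curl V) y y) (fderiv ℝ (curl V) y (V y))) (by positivity : (0 : ℝ) ≤ (1 + ‖y‖) ^ 2)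
    linarith [h, t1, t2, hΩ, t4, t5]
  set T := fderiv ℝ V y (curl V y) + (Δ (curl V)) y - curl V y - (1 / 2 : ℝ) • fderiv ℝ (curl V) y y
    - fderiv ℝ (curl V) y (V y)
  rw [show (1 + ‖y‖) ^ 4 * (‖T‖ * ‖curl V y‖) = ((1 + ‖y‖) ^ 2 * ‖T‖) * ((1 + ‖y‖) ^ 2 * ‖curl V y‖) by ring]
  exact mul_le_mul hT hΩ (by positivity) (by positivity)

/-- **Integrability on one slice in the profile class** (`V ∈ C³` with the four profile bounds):
`|Ω|²`, `|DΩ|²_F`, the stretching density `⟪Ω,(DV)Ω⟫`, `(1+|y|)|Ω|‖DΩ‖`, `‖DΩ‖²`, `|ΔΩ||Ω|` are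
integrable on `ℝ³` (all `O((1+|y|)⁻⁴)`, `hubbleDilution_integrable(_of_le)`); moreover `|V| ≤ K`
and `|Ω|² ≤ (κK)²(1+|y|)⁻⁴`. -/
theorem enstrophy_slice_integrable {V : EuclideanSpace ℝ (Fin 3) → EuclideanSpace ℝ (Fin 3)}
    (hV3 : ContDiff ℝ 3 V) {K : ℝ} (hK0 : 0 ≤ K)
    (hK : ∀ y, (1 + ‖y‖) * ‖V y‖ ≤ K ∧ (1 + ‖y‖) ^ 2 * ‖fderiv ℝ V y‖ ≤ K ∧
      (1 + ‖y‖) ^ 3 * ‖fderiv ℝ (curl V) y‖ ≤ K ∧ (1 + ‖y‖) ^ 4 * ‖(Δ (curl V)) y‖ ≤ K) :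
    Integrable (fun y => ‖curl V y‖ ^ 2) ∧
    Integrable (fun y => frobeniusNormSq (fderiv ℝ (curl V) y)) ∧
    Integrable (fun y => ⟪curl V y, fderiv ℝ V y (curl V y)⟫) ∧
    Integrable (fun y => (1 + ‖y‖) * (‖curl V y‖ * ‖fderiv ℝ (curl V) y‖)) ∧
    Integrable (fun y => ‖fderiv ℝ (curl V) y‖ ^ 2) ∧
    Integrable (fun y => ‖(Δ (curl V)) y‖ * ‖curl V y‖) ∧
    (∀ y, ‖V y‖ ≤ K) ∧ (∀ y, ‖curl V y‖ ^ 2 ≤ (‖curlCLM‖ * K) ^ 2 * ((1 + ‖y‖) ^ 4)⁻¹) := by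
  have hV2 : ContDiff ℝ 2 V := hV3.of_le (by norm_cast)
  have hΩ2c : ContDiff ℝ 2 (curl V) := PineauVicol2026.contDiff_two_curl hV3
  have hΩ1 : ContDiff ℝ 1 (curl V) := hΩ2c.of_le one_le_two
  have cΩ : Continuous (curl V) := hΩ1.continuous
  have cDΩ : Continuous (fderiv ℝ (curl V)) := hΩ1.continuous_fderiv one_ne_zero
  have cΔ : Continuous (Δ (curl V)) := continuous_laplacian hΩ2c
  have hr1 : ∀ y : EuclideanSpace ℝ (Fin 3), (1 : ℝ) ≤ 1 + ‖y‖ := fun y => by linarith [norm_nonneg y]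
  obtain ⟨i1, i2, i3, -, -, hVK⟩ := hubbleDilution_integrable hV2 (C := K) fun y =>
    ⟨(le_div_iff₀' (by positivity)).2 (hK y).1, (le_div_iff₀' (by positivity)).2 (hK y).2.1,
      (le_div_iff₀' (by positivity)).2 (hK y).2.2.1⟩
  set κ : ℝ := ‖curlCLM‖ with hκ
  have hΩ : ∀ y, (1 + ‖y‖) ^ 2 * ‖curl V y‖ ≤ κ * K := fun y => (enstrophy_pointwise hK0 hK y).1
  refine ⟨i1, i2, i3, ?_, ?_, ?_, hVK, fun y => ?_⟩
  · -- `(1+|y|)|Ω|‖DΩ‖ ≤ κK²/(1+|y|)⁴`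
    refine hubbleDilution_integrable_of_le (K := κ * K * K) (k := 4)
      ((continuous_const.add continuous_norm).mul (cΩ.norm.mul cDΩ.norm)) le_rfl fun y => ?_
    rw [Real.norm_of_nonneg (by positivity), ← div_eq_mul_inv, le_div_iff₀ (by positivity)]
    calc (1 + ‖y‖) * (‖curl V y‖ * ‖fderiv ℝ (curl V) y‖) * (1 + ‖y‖) ^ 4
        = ((1 + ‖y‖) ^ 2 * ‖curl V y‖) * ((1 + ‖y‖) ^ 3 * ‖fderiv ℝ (curl V) y‖) := by ring
      _ ≤ κ * K * K := mul_le_mul (hΩ y) (hK y).2.2.1 (by positivity) (by positivity)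
  · -- `‖DΩ‖² ≤ K²/(1+|y|)⁶ ≤ K²/(1+|y|)⁴`
    refine hubbleDilution_integrable_of_le (K := K ^ 2) (k := 4) (cDΩ.norm.pow 2) le_rfl fun y => ?_
    rw [Real.norm_of_nonneg (sq_nonneg _), ← div_eq_mul_inv, le_div_iff₀ (by positivity)]
    calc ‖fderiv ℝ (curl V) y‖ ^ 2 * (1 + ‖y‖) ^ 4 ≤ ‖fderiv ℝ (curl V) y‖ ^ 2 * (1 + ‖y‖) ^ 6 :=
          mul_le_mul_of_nonneg_left (pow_le_pow_right₀ (hr1 y) (by norm_num)) (sq_nonneg _)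
      _ = ((1 + ‖y‖) ^ 3 * ‖fderiv ℝ (curl V) y‖) ^ 2 := by ring
      _ ≤ K ^ 2 := pow_le_pow_left₀ (by positivity) (hK y).2.2.1 2
  · -- `|ΔΩ||Ω| ≤ κK²/(1+|y|)⁶ ≤ κK²/(1+|y|)⁴`
    refine hubbleDilution_integrable_of_le (K := K * (κ * K)) (k := 4) (cΔ.norm.mul cΩ.norm) le_rfl
      fun y => ?_
    rw [Real.norm_of_nonneg (by positivity), ← div_eq_mul_inv, le_div_iff₀ (by positivity)]
    calc ‖(Δ (curl V)) y‖ * ‖curl V y‖ * (1 + ‖y‖) ^ 4 ≤ ‖(Δ (curl V)) y‖ * ‖curl V y‖ * (1 + ‖y‖) ^ 6 :=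
          mul_le_mul_of_nonneg_left (pow_le_pow_right₀ (hr1 y) (by norm_num)) (by positivity)
      _ = ((1 + ‖y‖) ^ 4 * ‖(Δ (curl V)) y‖) * ((1 + ‖y‖) ^ 2 * ‖curl V y‖) := by ring
      _ ≤ K * (κ * K) := mul_le_mul (hK y).2.2.2 (hΩ y) (by positivity) hK0
  · -- `|Ω|² ≤ (κK)²/(1+|y|)⁴`
    rw [← div_eq_mul_inv, le_div_iff₀ (by positivity)]
    calc ‖curl V y‖ ^ 2 * (1 + ‖y‖) ^ 4 = ((1 + ‖y‖) ^ 2 * ‖curl V y‖) ^ 2 := by ring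
      _ ≤ (κ * K) ^ 2 := pow_le_pow_left₀ (by positivity) (hΩ y) 2

/-- `C (1+|y|)⁻⁴` is integrable on `ℝ³`. -/
theorem enstrophy_integrable_weight (C : ℝ) : Integrable fun y : EuclideanSpace ℝ (Fin 3) => C * ((1 + ‖y‖) ^ 4)⁻¹ := by
  refine hubbleDilution_integrable_of_le (K := |C|) (k := 4) ?_ le_rfl fun y => ?_
  · have hc : Continuous fun y : EuclideanSpace ℝ (Fin 3) => (1 + ‖y‖) ^ 4 :=
      (continuous_const.add continuous_norm).pow 4
    exact continuous_const.mul (hc.inv₀ fun y => (pow_pos (by positivity : (0 : ℝ) < 1 + ‖y‖) 4).ne')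
  · rw [norm_mul, Real.norm_eq_abs, Real.norm_of_nonneg (by positivity)]

/-! ### The stretching bound and the slice inequality -/

/-- **The stretching bound.** For `V ∈ C²` with `|V| ≤ C₀` and `Ω = curl V` (`div Ω = 0`):
`∫⟪Ω,(DV)Ω⟫ = −∫⟪V,(DΩ)Ω⟫ ≤ ∫‖DΩ‖² + (C₀²/4)∫|Ω|²` — the divergence
`div(⟪V,Ω⟫Ω) = ⟪V,(DΩ)Ω⟫ + ⟪Ω,(DV)Ω⟫` integrates to zero
(`PineauVicol2026.integral_divergence_eq_zero_of_integrable_div`), and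
`C₀|Ω|‖DΩ‖ ≤ ‖DΩ‖² + (C₀²/4)|Ω|²` pointwise. -/
theorem enstrophy_stretch_le {V : EuclideanSpace ℝ (Fin 3) → EuclideanSpace ℝ (Fin 3)} (hV2 : ContDiff ℝ 2 V)
    {C₀ : ℝ} (hVb : ∀ y, ‖V y‖ ≤ C₀) (h2 : Integrable fun y => ‖curl V y‖ ^ 2)
    (hS : Integrable fun y => ⟪curl V y, fderiv ℝ V y (curl V y)⟫)
    (hΩD : Integrable fun y => ‖curl V y‖ * ‖fderiv ℝ (curl V) y‖)
    (hD2 : Integrable fun y => ‖fderiv ℝ (curl V) y‖ ^ 2) :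
    ∫ y, ⟪curl V y, fderiv ℝ V y (curl V y)⟫ ≤
      (∫ y, ‖fderiv ℝ (curl V) y‖ ^ 2) + C₀ ^ 2 / 4 * ∫ y, ‖curl V y‖ ^ 2 := by
  have hC0 : 0 ≤ C₀ := (norm_nonneg _).trans (hVb 0)
  have hV1 : ContDiff ℝ 1 V := hV2.of_le one_le_two
  have hΩ1 : ContDiff ℝ 1 (curl V) := contDiff_curl (n := 1) (by exact_mod_cast hV2)
  have hVd : ∀ y, DifferentiableAt ℝ V y := fun y => hV1.differentiable one_ne_zero y
  have hΩd : ∀ y, DifferentiableAt ℝ (curl V) y := fun y => hΩ1.differentiable one_ne_zero y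
  have cDΩ : Continuous (fderiv ℝ (curl V)) := hΩ1.continuous_fderiv one_ne_zero
  -- the flux `⟪V,Ω⟫Ω`, its divergence, and `|⟪V,(DΩ)Ω⟫| ≤ C₀|Ω|‖DΩ‖`
  have hθ : ContDiff ℝ 1 fun y => ⟪V y, curl V y⟫ := hV1.inner ℝ hΩ1
  have hF1 : ContDiff ℝ 1 fun y => ⟪V y, curl V y⟫ • curl V y := hθ.smul hΩ1
  have hdivF : ∀ y, VectorCalculus.divergence (fun z => ⟪V z, curl V z⟫ • curl V z) y =
      ⟪V y, fderiv ℝ (curl V) y (curl V y)⟫ + ⟪curl V y, fderiv ℝ V y (curl V y)⟫ := by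
    intro y
    rw [divergence_smul_apply (hθ.differentiable one_ne_zero y) (hΩd y), divergence_curl_eq_zero_holds V hV2 y,
      mul_zero, zero_add, gradient, real_inner_comm, InnerProductSpace.toDual_symm_apply,
      fderiv_inner_apply ℝ (hVd y) (hΩd y), real_inner_comm (curl V y) (fderiv ℝ V y (curl V y))]
  have hpt : ∀ y, |⟪V y, fderiv ℝ (curl V) y (curl V y)⟫| ≤ C₀ * (‖curl V y‖ * ‖fderiv ℝ (curl V) y‖) :=
    fun y => calc
      |⟪V y, fderiv ℝ (curl V) y (curl V y)⟫| ≤ ‖V y‖ * ‖fderiv ℝ (curl V) y (curl V y)‖ := abs_real_inner_le_norm _ _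
      _ ≤ C₀ * (‖fderiv ℝ (curl V) y‖ * ‖curl V y‖) :=
          mul_le_mul (hVb y) ((fderiv ℝ (curl V) y).le_opNorm _) (norm_nonneg _) hC0
      _ = C₀ * (‖curl V y‖ * ‖fderiv ℝ (curl V) y‖) := by ring
  have hI : Integrable fun y => ⟪V y, fderiv ℝ (curl V) y (curl V y)⟫ :=
    (hΩD.const_mul C₀).mono' (hV1.continuous.inner (cDΩ.clm_apply hΩ1.continuous)).aestronglyMeasurable
      (Eventually.of_forall fun y => by rw [Real.norm_eq_abs]; exact hpt y)
  have hFi : Integrable fun y => ‖⟪V y, curl V y⟫ • curl V y‖ / (1 + ‖y‖) := by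
    refine (h2.const_mul C₀).mono' ?_ (Eventually.of_forall fun y => ?_)
    · exact (hF1.continuous.norm.div (continuous_const.add continuous_norm)
        fun y => (by positivity : (0 : ℝ) < 1 + ‖y‖).ne').aestronglyMeasurable
    · rw [Real.norm_of_nonneg (by positivity), norm_smul]
      refine (div_le_self (by positivity) (by linarith [norm_nonneg y])).trans ?_
      calc ‖⟪V y, curl V y⟫‖ * ‖curl V y‖ ≤ ‖V y‖ * ‖curl V y‖ * ‖curl V y‖ :=
            mul_le_mul_of_nonneg_right (norm_inner_le_norm _ _) (norm_nonneg _)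
        _ ≤ C₀ * ‖curl V y‖ * ‖curl V y‖ := by gcongr; exact hVb y
        _ = C₀ * ‖curl V y‖ ^ 2 := by ring
  have hdi : Integrable fun y => VectorCalculus.divergence (fun z => ⟪V z, curl V z⟫ • curl V z) y := by
    simp_rw [hdivF]; exact hI.add hS
  have h0 := PineauVicol2026.integral_divergence_eq_zero_of_integrable_div hF1 hFi hdi
  simp_rw [hdivF] at h0
  rw [integral_add hI hS] at h0
  -- Young pointwise and integration
  have hY : ∀ y, -⟪V y, fderiv ℝ (curl V) y (curl V y)⟫ ≤ ‖fderiv ℝ (curl V) y‖ ^ 2 + C₀ ^ 2 / 4 * ‖curl V y‖ ^ 2 :=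
    fun y => by
      nlinarith [(neg_le_abs _).trans (hpt y), sq_nonneg (‖fderiv ℝ (curl V) y‖ - C₀ * ‖curl V y‖ / 2)]
  calc ∫ y, ⟪curl V y, fderiv ℝ V y (curl V y)⟫ = ∫ y, -⟪V y, fderiv ℝ (curl V) y (curl V y)⟫ := by
        rw [integral_neg]; linarith
    _ ≤ ∫ y, (‖fderiv ℝ (curl V) y‖ ^ 2 + C₀ ^ 2 / 4 * ‖curl V y‖ ^ 2) :=
        integral_mono hI.neg (hD2.add (h2.const_mul _)) hY
    _ = (∫ y, ‖fderiv ℝ (curl V) y‖ ^ 2) + C₀ ^ 2 / 4 * ∫ y, ‖curl V y‖ ^ 2 := by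
        rw [integral_add hD2 (h2.const_mul _), integral_const_mul]

/-- **The slice inequality** `∫⟪∂ₛΩ,Ω⟫ ≤ −¼(1 − C₀²)‖Ω‖₂²` for an eternal backward-Leray flow
whose slice `U(s)` is bounded by `C₀` and lies in the profile class: the enstrophy identity
`∫⟪∂ₛΩ,Ω⟫ + ¼‖Ω‖₂² + ∫|DΩ|²_F = ∫⟪Ω,(DU)Ω⟫` (`PineauVicol2026.enstrophy_slice`), the stretching
bound `enstrophy_stretch_le` and `‖DΩ‖² ≤ |DΩ|²_F`. -/
theorem enstrophy_slice_le {U : ℝ → EuclideanSpace ℝ (Fin 3) → EuclideanSpace ℝ (Fin 3)}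
    {P : ℝ → EuclideanSpace ℝ (Fin 3) → ℝ} (h : IsBackwardLeraySolutionOn univ 1 U P) (s : ℝ) {C₀ K : ℝ}
    (hUb : ∀ y, ‖U s y‖ ≤ C₀) (hK0 : 0 ≤ K)
    (hK : ∀ y, (1 + ‖y‖) * ‖U s y‖ ≤ K ∧ (1 + ‖y‖) ^ 2 * ‖fderiv ℝ (U s) y‖ ≤ K ∧
      (1 + ‖y‖) ^ 3 * ‖fderiv ℝ (curl (U s)) y‖ ≤ K ∧ (1 + ‖y‖) ^ 4 * ‖(Δ (curl (U s))) y‖ ≤ K) :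
    ∫ y, ⟪timeDerivWithin univ (vorticity U) s y, curl (U s) y⟫ ≤
      -((1 - C₀ ^ 2) / 4) * ∫ y, ‖curl (U s) y‖ ^ 2 := by
  have hUs : ContDiff ℝ ∞ (U s) := h.smooth_velocity.contDiff_slice (mem_univ s)
  have hU2 : ContDiff ℝ 2 (U s) := hUs.of_le (by norm_cast)
  have hΩ1 : ContDiff ℝ 1 (curl (U s)) := contDiff_curl (n := 1) (by exact_mod_cast hU2)
  obtain ⟨i1, i2, i3, i4, i5, i6, -⟩ := enstrophy_slice_integrable (hUs.of_le (by norm_cast)) hK0 hK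
  have e := PineauVicol2026.enstrophy_slice h s hUb i1 i4 i5 i6 i3
  have hΩD : Integrable fun y => ‖curl (U s) y‖ * ‖fderiv ℝ (curl (U s)) y‖ :=
    i4.mono' (hΩ1.continuous.norm.mul (hΩ1.continuous_fderiv one_ne_zero).norm).aestronglyMeasurable
      (Eventually.of_forall fun y => by
        rw [Real.norm_of_nonneg (by positivity)]
        exact le_mul_of_one_le_left (by positivity) (by linarith [norm_nonneg y]))
  have hst := enstrophy_stretch_le hU2 hUb i1 i3 hΩD i5
  have hfrob : ∫ y, ‖fderiv ℝ (curl (U s)) y‖ ^ 2 ≤ ∫ y, frobeniusNormSq (fderiv ℝ (curl (U s)) y) :=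
    integral_mono i5 i2 fun y => norm_sq_le_frobeniusNormSq _
  linarith

/-! ### The stub -/

/-- **`stub_enstrophyBalance`** (stub 4a of the line `registered` of the crux `NoSelfExcitedDynamo`;
Pineau–Vicol 2026 (7.12), the route's `DilutionBudget` with its exact `−¼` bonus, time-dependent).
For an eternal solution of the backward Leray system in the uniform profile class with `|U| ≤ C₀`,
the enstrophy `E(s) = ∫ |curl U(s)|²` is finite, bounded in `s`, and
`E(s₁) − E(s₀) ≤ −½(1 − C₀²) ∫_{s₀}^{s₁} E` for `s₀ ≤ s₁`: the slice inequality
`∫⟪∂ₛΩ,Ω⟫ ≤ −¼(1 − C₀²)E` (`enstrophy_slice_le`) integrated in `s`, where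
`∫_{s₀}^{s₁}∫⟪∂ₛΩ,Ω⟫ = ½(E(s₁) − E(s₀))` by Fubini and the fundamental theorem of calculus with
the uniform dominator `|⟪∂ₛΩ,Ω⟫| ≤ A(1+|y|)⁻⁴` from the vorticity equation. -/
theorem stub_enstrophyBalance :
    ∀ (U : ℝ → EuclideanSpace ℝ (Fin 3) → EuclideanSpace ℝ (Fin 3)) (P : ℝ → EuclideanSpace ℝ (Fin 3) → ℝ) (C₀ : ℝ),
      IsBackwardLeraySolutionOn univ 1 U P →
      (∀ k : ℕ, ∃ K : ℝ, ∀ s y, (1 + ‖y‖) ^ (k + 1) * ‖iteratedFDeriv ℝ k (U s) y‖ ≤ K) →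
      (∀ s y, ‖U s y‖ ≤ C₀) →
      (∀ s, Integrable (fun y => ‖curl (U s) y‖ ^ 2) volume) ∧
      (∃ M : ℝ, ∀ s, ∫ y, ‖curl (U s) y‖ ^ 2 ≤ M) ∧
      (∀ s₀ s₁ : ℝ, s₀ ≤ s₁ →
        (∫ y, ‖curl (U s₁) y‖ ^ 2) - (∫ y, ‖curl (U s₀) y‖ ^ 2) ≤
          -((1 - C₀ ^ 2) / 2) * ∫ s in s₀..s₁, (∫ y, ‖curl (U s) y‖ ^ 2)) := by
  intro U P C₀ h hdec hUb
  have hsm : IsSmoothSpaceTimeOn univ U := h.smooth_velocity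
  have hU3 : ∀ s, ContDiff ℝ 3 (U s) := fun s => (hsm.contDiff_slice (mem_univ s)).of_le (by norm_cast)
  obtain ⟨K, hK0, hK⟩ := enstrophy_decay hU3 hdec
  set κ : ℝ := ‖curlCLM‖ with hκ
  -- finiteness and boundedness of the enstrophy
  have hE : ∀ s, Integrable (fun y => ‖curl (U s) y‖ ^ 2) volume := fun s =>
    (enstrophy_slice_integrable (hU3 s) hK0 (hK s)).1
  have hΩ2 : ∀ s y, ‖curl (U s) y‖ ^ 2 ≤ (κ * K) ^ 2 * ((1 + ‖y‖) ^ 4)⁻¹ := fun s =>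
    (enstrophy_slice_integrable (hU3 s) hK0 (hK s)).2.2.2.2.2.2.2
  refine ⟨hE, ⟨_, fun s => integral_mono (hE s) (enstrophy_integrable_weight _) (hΩ2 s)⟩, fun s₀ s₁ hle => ?_⟩
  -- joint continuity of the two densities `⟪∂ₛΩ,Ω⟫` and `|Ω|²`
  have hΩsm : IsSmoothSpaceTimeOn univ (vorticity U) := hsm.isSmoothSpaceTimeOn_vorticity uniqueDiffOn_univ
  have hΩc := PineauVicol2026.continuous_uncurry_of_isSmoothSpaceTimeOn_univ hΩsm
  have hTc := PineauVicol2026.continuous_uncurry_of_isSmoothSpaceTimeOn_univ (hΩsm.timeDerivWithin uniqueDiffOn_univ)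
  set f : ℝ → EuclideanSpace ℝ (Fin 3) → ℝ := fun s y => ⟪timeDerivWithin univ (vorticity U) s y, curl (U s) y⟫
    with hf
  have hfc : Continuous (uncurry f) := by
    have : uncurry f = fun z : ℝ × EuclideanSpace ℝ (Fin 3) =>
        ⟪timeDerivWithin univ (vorticity U) z.1 z.2, vorticity U z.1 z.2⟫ := by
      funext z; simp [hf, uncurry, vorticity_apply]
    rw [this]; exact hTc.inner hΩc
  set e : ℝ → EuclideanSpace ℝ (Fin 3) → ℝ := fun s y => ‖curl (U s) y‖ ^ 2 with he
  have hec : Continuous (uncurry e) := by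
    have : uncurry e = fun z : ℝ × EuclideanSpace ℝ (Fin 3) => ‖vorticity U z.1 z.2‖ ^ 2 := by
      funext z; simp [he, uncurry, vorticity_apply]
    rw [this]; exact (hΩc.norm).pow 2
  -- the uniform dominator of `⟪∂ₛΩ,Ω⟫` from the vorticity equation
  set A : ℝ := (K * (κ * K) + K + κ * K + K / 2 + K * K) * (κ * K) with hA
  have hdomf : ∀ s y, |f s y| ≤ A * ((1 + ‖y‖) ^ 4)⁻¹ := by
    intro s y
    have eq := h.vorticity_eq uniqueDiffOn_univ (by simp) (mem_univ s) y
    simp only [vorticity_apply, convect_apply, one_smul] at eq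
    have e' : timeDerivWithin univ (vorticity U) s y = fderiv ℝ (U s) y (curl (U s) y) + (Δ (curl (U s))) y -
        curl (U s) y - (1 / 2 : ℝ) • fderiv ℝ (curl (U s)) y y - fderiv ℝ (curl (U s)) y (U s y) := by
      rw [← eq]; abel
    show |⟪timeDerivWithin univ (vorticity U) s y, curl (U s) y⟫| ≤ A * ((1 + ‖y‖) ^ 4)⁻¹
    rw [e', ← div_eq_mul_inv, le_div_iff₀' (by positivity)]
    exact (mul_le_mul_of_nonneg_left (abs_real_inner_le_norm _ _) (by positivity)).trans
      (enstrophy_pointwise hK0 (hK s) y).2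
  -- integrability on the strip `(s₀, s₁] × ℝ³`
  set μ : Measure ℝ := volume.restrict (Ioc s₀ s₁) with hμ
  have h1i : Integrable (fun _ : ℝ => (1 : ℝ)) μ := by
    have : IntegrableOn (fun _ : ℝ => (1 : ℝ)) (Ioc s₀ s₁) (volume : Measure ℝ) :=
      integrableOn_const measure_Ioc_lt_top.ne
    rw [hμ]; exact this
  have hFi : Integrable (uncurry f) (μ.prod volume) :=
    (h1i.mul_prod (enstrophy_integrable_weight A)).mono' hfc.aestronglyMeasurable
      (Eventually.of_forall fun z => by rw [one_mul, Real.norm_eq_abs]; exact hdomf z.1 z.2)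
  have hEi : Integrable (uncurry e) (μ.prod volume) :=
    (h1i.mul_prod (enstrophy_integrable_weight ((κ * K) ^ 2))).mono' hec.aestronglyMeasurable
      (Eventually.of_forall fun z => by
        rw [one_mul, Real.norm_eq_abs]
        exact (abs_of_nonneg (sq_nonneg _)).trans_le (hΩ2 z.1 z.2))
  -- Fubini and the fundamental theorem of calculus in `s`, pointwise in `y`
  have hFTC : ∀ y, ∫ s, f s y ∂μ = (1 / 2) * ‖curl (U s₁) y‖ ^ 2 - (1 / 2) * ‖curl (U s₀) y‖ ^ 2 := by
    intro y
    rw [hμ, ← intervalIntegral.integral_of_le hle]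
    have hderiv : ∀ s ∈ uIcc s₀ s₁, HasDerivAt (fun s => (1 / 2) * ‖vorticity U s y‖ ^ 2) (f s y) s := by
      intro s _
      have h1 : HasDerivAt (fun s => vorticity U s y) (timeDerivWithin univ (vorticity U) s y) s :=
        hasDerivWithinAt_univ.1 (hΩsm.hasDerivWithinAt_timeDerivWithin uniqueDiffOn_univ (mem_univ s) y)
      refine ((h1.norm_sq).const_mul (1 / 2 : ℝ)).congr_deriv ?_
      simp only [hf, vorticity_apply, real_inner_comm (curl (U s) y)]
      ring
    rw [intervalIntegral.integral_eq_sub_of_hasDerivAt hderiv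
      ((hfc.comp (continuous_id.prodMk continuous_const)).intervalIntegrable _ _)]
    simp [vorticity_apply]
  have hTint : ∫ s, (∫ y, f s y) ∂μ =
      (1 / 2) * (∫ y, ‖curl (U s₁) y‖ ^ 2) - (1 / 2) * ∫ y, ‖curl (U s₀) y‖ ^ 2 := by
    rw [integral_integral_swap hFi, integral_congr_ae (Eventually.of_forall hFTC),
      integral_sub ((hE s₁).const_mul _) ((hE s₀).const_mul _), integral_const_mul, integral_const_mul]
  -- integrate the slice inequality over `(s₀, s₁]`
  have hmono : ∫ s, (∫ y, f s y) ∂μ ≤ ∫ s, -((1 - C₀ ^ 2) / 4) * (∫ y, e s y) ∂μ :=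
    integral_mono hFi.integral_prod_left (hEi.integral_prod_left.const_mul _) fun s =>
      enstrophy_slice_le h s (hUb s) hK0 (hK s)
  rw [integral_const_mul] at hmono
  rw [intervalIntegral.integral_of_le hle]
  change _ ≤ -((1 - C₀ ^ 2) / 2) * ∫ s, (∫ y, e s y) ∂μ
  linarith [hTint, hmono]

end Summit.NavierStokesRegularity.NavierStokesRegularity.Theorems.NoSelfExcitedDynamo.Registered
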